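import Summits.MatrixMultiplication.OmegaCensus.VertexCountingCore
import HarnessLib

/-!
# Arithmetic of the eight vertex constraints, II: total slack `≤ 31` forces two balanced pairs (`4 ∣ V`)

ω-census, family (b3).  Framing: lottery ticket; floor = certified bounds/negative ranges.

Setting of `VertexCountingCore.lean`: non-negative integers `s₀, s₁, t₀, t₁, u₀, u₁` (coset part sizes of a TPP triple
of a dihedral-like group), volume `V = (s₀+s₁)(t₀+t₁)(u₀+u₁)`, a modulus `N` with the eight vertex constraints, and the
total slack `D = 8N − 3V ≥ 0`.  There: `V ≥ 33`, `D ≤ 13 ⇒ 4 ∣ D`.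

**Theorem (`two_balanced_of_vertex_bounds31`).** If `V ≥ 127` and `D ≤ 31` then two of the three part pairs are
balanced (`s₀ = s₁ ∧ t₀ = t₁`, or `s₀ = s₁ ∧ u₀ = u₁`, or `t₀ = t₁ ∧ u₀ = u₁`); in particular **`4 ∣ V`**
(`four_dvd_volume_of_vertex_bounds31`), i.e. `D ≡ 8N (mod 12)`.

Both thresholds are sharp: `(1,1 | 3,4 | 4,5)` (one balanced pair) satisfies all eight constraints with `N = 51`,
`V = 126`, `D = 30`; and `D = 32` admits every cube `(c,c | d,d | e,e)` with `N = 3cde + 4`.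

**Proof.** `8·slackᵥ = D − V + 8 p(v̄) + 4(−1)^{|v|} αβγ` (`α = s₀ − s₁`, `β = t₀ − t₁`, `γ = u₀ − u₁`, `p(w)` the box
products): the slack at a vertex is governed by the antipodal box.
* One balanced pair (`s₀ = s₁ = s`, `t₁ = t₀+a+1`, `u₁ = u₀+b+1`): the constraint omitting `t₀u₀` reads `2sE ≤ D` with
  `E = 2t₀(b+1) + 2u₀(a+1) + (a+1)(b+1)` and `V = 8st₀u₀ + 2sE`; so `sE ≤ 15`, `s(2t₀+2u₀+1) ≤ 15`, `st₀u₀ ≤ 12` and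
  `V ≤ 96 + 30` (`one_balanced_core31`).
* No balanced pair (wlog `s₁ < s₀`, `t₁ < t₀`, `u₁ < u₀`): the four odd vertices give `3αβγ ≤ D` (`αβγ ≤ 10`), the
  antipodal vertex pairs give `Sβγ, Tαγ, Uαβ ≤ D ≤ 31`, and a finite check over that box (`vertex_fc31`, 11 851
  evaluations, `decide`) gives `V ≤ 126` (in fact `V ≤ 54`).
Consequences for dihedral-like groups (`|A| ≥ 52`: `4 ∣ |S||T||U|` or `3|S||T||U| + 32 ≤ 8|A|`; for `|A| ≡ 1 (mod 3)`
the volumes `law − 1, −2, −3, −5, −6, −7` never occur): `DihedralLikeLawGap12.lean`.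
-/

namespace Summit.MatrixMultiplication.OmegaCensus

/-! ## One balanced pair: `V ≤ 126` -/

/-- One balanced pair, core case (`s₀ = s₁ = s`, `t₀ < t₁`, `u₀ < u₁`): the vertex constraint omitting `t₀u₀` together
with `8N ≤ 3V + 31` forces `V ≤ 126`. [folklore] -/
theorem one_balanced_core31 (N s t₀ t₁ u₀ u₁ : ℕ) (ht : t₀ < t₁) (hu : u₀ < u₁)
    (hL : s * t₁ * u₁ + s * t₀ * u₁ + s * t₁ * u₀ ≤ N)
    (hD : 8 * N ≤ 3 * ((s + s) * (t₀ + t₁) * (u₀ + u₁)) + 31) :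
    (s + s) * (t₀ + t₁) * (u₀ + u₁) ≤ 126 := by
  obtain ⟨a, rfl⟩ : ∃ a, t₁ = t₀ + a + 1 := ⟨t₁ - t₀ - 1, by omega⟩
  obtain ⟨b, rfl⟩ : ∃ b, u₁ = u₀ + b + 1 := ⟨u₁ - u₀ - 1, by omega⟩
  have h1 : 8 * (s * (t₀ + a + 1) * (u₀ + b + 1) + s * t₀ * (u₀ + b + 1) + s * (t₀ + a + 1) * u₀) ≤
      3 * ((s + s) * (t₀ + (t₀ + a + 1)) * (u₀ + (u₀ + b + 1))) + 31 := le_trans (Nat.mul_le_mul_left 8 hL) hD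
  -- the slack inequality `2 s E ≤ 31`, `E = 2t₀(b+1) + 2u₀(a+1) + (a+1)(b+1)`
  have h2 : 2 * (s * (2 * (t₀ * b) + 2 * t₀ + 2 * (a * u₀) + 2 * u₀ + a * b + a + b + 1)) ≤ 31 := by
    nlinarith [h1]
  have hV : (s + s) * (t₀ + (t₀ + a + 1)) * (u₀ + (u₀ + b + 1)) =
      8 * (s * t₀ * u₀) + 2 * (s * (2 * (t₀ * b) + 2 * t₀ + 2 * (a * u₀) + 2 * u₀ + a * b + a + b + 1)) := by
    ring
  have h3 : s * (2 * (t₀ * b) + 2 * t₀ + 2 * (a * u₀) + 2 * u₀ + a * b + a + b + 1) ≤ 15 := by omega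
  have hE : 2 * t₀ + 2 * u₀ + 1 ≤ 2 * (t₀ * b) + 2 * t₀ + 2 * (a * u₀) + 2 * u₀ + a * b + a + b + 1 := by
    have h0 : 0 ≤ 2 * (t₀ * b) + 2 * (a * u₀) + a * b + a + b := Nat.zero_le _
    omega
  have h4 : s * (2 * t₀ + 2 * u₀ + 1) ≤ 15 := le_trans (Nat.mul_le_mul_left s hE) h3
  rw [hV]
  rcases Nat.eq_zero_or_pos s with rfl | hs
  · simp
  have h5 : 2 * t₀ + 2 * u₀ + 1 ≤ 15 := le_trans (Nat.le_mul_of_pos_left _ hs) h4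
  have ht7 : t₀ ≤ 7 := by omega
  have hu7 : u₀ ≤ 7 := by omega
  interval_cases t₀ <;> interval_cases u₀ <;> omega

/-- One balanced pair (`s₀ = s₁ = s`, `t₀ ≠ t₁`, `u₀ ≠ u₁`), all four "omit one product `t_j u_k`" vertex constraints
available: `8N ≤ 3V + 31` forces `V ≤ 126`. [folklore] -/
theorem one_balanced_le31 (N s t₀ t₁ u₀ u₁ : ℕ) (ht : t₀ ≠ t₁) (hu : u₀ ≠ u₁)
    (h00 : s * t₁ * u₁ + s * t₀ * u₁ + s * t₁ * u₀ ≤ N) (h11 : s * t₀ * u₀ + s * t₁ * u₀ + s * t₀ * u₁ ≤ N)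
    (h01 : s * t₀ * u₀ + s * t₁ * u₀ + s * t₁ * u₁ ≤ N) (h10 : s * t₀ * u₀ + s * t₀ * u₁ + s * t₁ * u₁ ≤ N)
    (hD : 8 * N ≤ 3 * ((s + s) * (t₀ + t₁) * (u₀ + u₁)) + 31) :
    (s + s) * (t₀ + t₁) * (u₀ + u₁) ≤ 126 := by
  rcases Nat.lt_or_gt_of_ne ht with ht' | ht' <;> rcases Nat.lt_or_gt_of_ne hu with hu' | hu'
  · exact one_balanced_core31 N s t₀ t₁ u₀ u₁ ht' hu' h00 hD
  · -- `t₀ < t₁`, `u₁ < u₀`: omit `t₀ u₁`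
    have key := one_balanced_core31 N s t₀ t₁ u₁ u₀ ht' hu' (by linarith) (by linarith)
    linarith
  · -- `t₁ < t₀`, `u₀ < u₁`: omit `t₁ u₀`
    have key := one_balanced_core31 N s t₁ t₀ u₀ u₁ ht' hu' (by linarith) (by linarith)
    linarith
  · -- `t₁ < t₀`, `u₁ < u₀`: omit `t₁ u₁`
    have key := one_balanced_core31 N s t₁ t₀ u₁ u₀ ht' hu' (by linarith) (by linarith)
    linarith

/-! ## No balanced pair: a finite check -/

/-- The finite check for the all-unbalanced case, normalised to `s₀ = s₁+a+1`, `t₀ = t₁+b+1`, `u₀ = u₁+c+1`: for all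
`(a,b,c,s₁,t₁,u₁)` in the box `(a+1)(b+1)(c+1) ≤ 10`, `(2s₁+a+1)(b+1)(c+1) ≤ 31`, `(2t₁+b+1)(a+1)(c+1) ≤ 31`,
`(2u₁+c+1)(a+1)(b+1) ≤ 31` (as `List.range` bounds), the eight inequalities `8·(vertex sum) ≤ 3V + 31` imply `V ≤ 126`
(11 851 evaluations). [folklore] -/
theorem vertex_fc31 :
    ((List.range 10).all fun a => (List.range (10 / (a + 1))).all fun b =>
      (List.range (10 / ((a + 1) * (b + 1)))).all fun c =>
      (List.range ((31 / ((b + 1) * (c + 1)) - (a + 1)) / 2 + 1)).all fun s₁ =>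
      (List.range ((31 / ((a + 1) * (c + 1)) - (b + 1)) / 2 + 1)).all fun t₁ =>
      (List.range ((31 / ((a + 1) * (b + 1)) - (c + 1)) / 2 + 1)).all fun u₁ =>
        decide (
          8 * (s₁ * (t₁ + b + 1) * (u₁ + c + 1) + (s₁ + a + 1) * t₁ * (u₁ + c + 1) + (s₁ + a + 1) * (t₁ + b + 1) * u₁) ≤
            3 * ((s₁ + a + 1 + s₁) * (t₁ + b + 1 + t₁) * (u₁ + c + 1 + u₁)) + 31 →
          8 * ((s₁ + a + 1) * t₁ * u₁ + s₁ * (t₁ + b + 1) * u₁ + s₁ * t₁ * (u₁ + c + 1)) ≤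
            3 * ((s₁ + a + 1 + s₁) * (t₁ + b + 1 + t₁) * (u₁ + c + 1 + u₁)) + 31 →
          8 * ((s₁ + a + 1) * (t₁ + b + 1) * (u₁ + c + 1) + s₁ * t₁ * (u₁ + c + 1) + s₁ * (t₁ + b + 1) * u₁) ≤
            3 * ((s₁ + a + 1 + s₁) * (t₁ + b + 1 + t₁) * (u₁ + c + 1 + u₁)) + 31 →
          8 * (s₁ * t₁ * u₁ + (s₁ + a + 1) * (t₁ + b + 1) * u₁ + (s₁ + a + 1) * t₁ * (u₁ + c + 1)) ≤
            3 * ((s₁ + a + 1 + s₁) * (t₁ + b + 1 + t₁) * (u₁ + c + 1 + u₁)) + 31 →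
          8 * (s₁ * t₁ * (u₁ + c + 1) + (s₁ + a + 1) * (t₁ + b + 1) * (u₁ + c + 1) + (s₁ + a + 1) * t₁ * u₁) ≤
            3 * ((s₁ + a + 1 + s₁) * (t₁ + b + 1 + t₁) * (u₁ + c + 1 + u₁)) + 31 →
          8 * ((s₁ + a + 1) * (t₁ + b + 1) * u₁ + s₁ * t₁ * u₁ + s₁ * (t₁ + b + 1) * (u₁ + c + 1)) ≤
            3 * ((s₁ + a + 1 + s₁) * (t₁ + b + 1 + t₁) * (u₁ + c + 1 + u₁)) + 31 →
          8 * (s₁ * (t₁ + b + 1) * u₁ + (s₁ + a + 1) * t₁ * u₁ + (s₁ + a + 1) * (t₁ + b + 1) * (u₁ + c + 1)) ≤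
            3 * ((s₁ + a + 1 + s₁) * (t₁ + b + 1 + t₁) * (u₁ + c + 1 + u₁)) + 31 →
          8 * ((s₁ + a + 1) * t₁ * (u₁ + c + 1) + s₁ * (t₁ + b + 1) * (u₁ + c + 1) + s₁ * t₁ * u₁) ≤
            3 * ((s₁ + a + 1 + s₁) * (t₁ + b + 1 + t₁) * (u₁ + c + 1 + u₁)) + 31 →
          (s₁ + a + 1 + s₁) * (t₁ + b + 1 + t₁) * (u₁ + c + 1 + u₁) ≤ 126)) = true := by
  decide

/-- The all-unbalanced case, normalised (`s₁ < s₀`, `t₁ < t₀`, `u₁ < u₀`): `8N ≤ 3V + 31` forces `V ≤ 126`.  The four odd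
vertices give `3(s₀−s₁)(t₀−t₁)(u₀−u₁) ≤ 31`, the antipodal pairs give `(s₀+s₁)(t₀−t₁)(u₀−u₁) ≤ 31` and its two
analogues, and `vertex_fc31` applies. [folklore] -/
theorem unbalanced_core31 (N s₀ s₁ t₀ t₁ u₀ u₁ : ℕ) (hs : s₁ < s₀) (ht : t₁ < t₀) (hu : u₁ < u₀)
    (h000 : s₁ * t₀ * u₀ + s₀ * t₁ * u₀ + s₀ * t₀ * u₁ ≤ N) (h111 : s₀ * t₁ * u₁ + s₁ * t₀ * u₁ + s₁ * t₁ * u₀ ≤ N)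
    (h100 : s₀ * t₀ * u₀ + s₁ * t₁ * u₀ + s₁ * t₀ * u₁ ≤ N) (h011 : s₁ * t₁ * u₁ + s₀ * t₀ * u₁ + s₀ * t₁ * u₀ ≤ N)
    (h010 : s₁ * t₁ * u₀ + s₀ * t₀ * u₀ + s₀ * t₁ * u₁ ≤ N) (h101 : s₀ * t₀ * u₁ + s₁ * t₁ * u₁ + s₁ * t₀ * u₀ ≤ N)
    (h001 : s₁ * t₀ * u₁ + s₀ * t₁ * u₁ + s₀ * t₀ * u₀ ≤ N) (h110 : s₀ * t₁ * u₀ + s₁ * t₀ * u₀ + s₁ * t₁ * u₁ ≤ N)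
    (hD : 8 * N ≤ 3 * ((s₀ + s₁) * (t₀ + t₁) * (u₀ + u₁)) + 31) :
    (s₀ + s₁) * (t₀ + t₁) * (u₀ + u₁) ≤ 126 := by
  obtain ⟨a, rfl⟩ : ∃ a, s₀ = s₁ + a + 1 := ⟨s₀ - s₁ - 1, by omega⟩
  obtain ⟨b, rfl⟩ : ∃ b, t₀ = t₁ + b + 1 := ⟨t₀ - t₁ - 1, by omega⟩
  obtain ⟨c, rfl⟩ : ∃ c, u₀ = u₁ + c + 1 := ⟨u₀ - u₁ - 1, by omega⟩
  -- `3αβγ ≤ D` (odd vertices) and `Sβγ, Tαγ, Uαβ ≤ D` (antipodal pairs)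
  have hO : 3 * ((a + 1) * (b + 1) * (c + 1)) ≤ 31 := by linarith
  have hX : (s₁ + a + 1 + s₁) * ((b + 1) * (c + 1)) ≤ 31 := by linarith
  have hY : (t₁ + b + 1 + t₁) * ((a + 1) * (c + 1)) ≤ 31 := by linarith
  have hZ : (u₁ + c + 1 + u₁) * ((a + 1) * (b + 1)) ≤ 31 := by linarith
  -- loop bounds
  have hP : (a + 1) * (b + 1) * (c + 1) ≤ 10 := by omega
  have hab : (a + 1) * (b + 1) ≤ 10 := le_trans (Nat.le_mul_of_pos_right _ (by omega)) hP
  have ha : a < 10 := by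
    have := Nat.le_mul_of_pos_right (a + 1) (show 0 < b + 1 by omega)
    omega
  have hb : b < 10 / (a + 1) := by
    have : b + 1 ≤ 10 / (a + 1) := (Nat.le_div_iff_mul_le (by omega)).2 (by rw [mul_comm]; exact hab)
    omega
  have hc : c < 10 / ((a + 1) * (b + 1)) := by
    have : c + 1 ≤ 10 / ((a + 1) * (b + 1)) := (Nat.le_div_iff_mul_le (by positivity)).2 (by rw [mul_comm]; exact hP)
    omega
  have hs₁ : s₁ < (31 / ((b + 1) * (c + 1)) - (a + 1)) / 2 + 1 := by
    have : s₁ + a + 1 + s₁ ≤ 31 / ((b + 1) * (c + 1)) := (Nat.le_div_iff_mul_le (by positivity)).2 hX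
    omega
  have ht₁ : t₁ < (31 / ((a + 1) * (c + 1)) - (b + 1)) / 2 + 1 := by
    have : t₁ + b + 1 + t₁ ≤ 31 / ((a + 1) * (c + 1)) := (Nat.le_div_iff_mul_le (by positivity)).2 hY
    omega
  have hu₁ : u₁ < (31 / ((a + 1) * (b + 1)) - (c + 1)) / 2 + 1 := by
    have : u₁ + c + 1 + u₁ ≤ 31 / ((a + 1) * (b + 1)) := (Nat.le_div_iff_mul_le (by positivity)).2 hZ
    omega
  have key := vertex_fc31
  simp only [List.all_eq_true, List.mem_range, decide_eq_true_iff] at key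
  exact key a ha b hb c hc s₁ hs₁ t₁ ht₁ u₁ hu₁ (by linarith) (by linarith) (by linarith) (by linarith) (by linarith)
    (by linarith) (by linarith) (by linarith)

/-- The all-unbalanced case (`s₀ ≠ s₁`, `t₀ ≠ t₁`, `u₀ ≠ u₁`): `8N ≤ 3V + 31` forces `V ≤ 126` (eight sign cases of
`unbalanced_core31`). [folklore] -/
theorem unbalanced_le31 (N s₀ s₁ t₀ t₁ u₀ u₁ : ℕ) (hs : s₀ ≠ s₁) (ht : t₀ ≠ t₁) (hu : u₀ ≠ u₁)
    (h000 : s₁ * t₀ * u₀ + s₀ * t₁ * u₀ + s₀ * t₀ * u₁ ≤ N) (h111 : s₀ * t₁ * u₁ + s₁ * t₀ * u₁ + s₁ * t₁ * u₀ ≤ N)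
    (h100 : s₀ * t₀ * u₀ + s₁ * t₁ * u₀ + s₁ * t₀ * u₁ ≤ N) (h011 : s₁ * t₁ * u₁ + s₀ * t₀ * u₁ + s₀ * t₁ * u₀ ≤ N)
    (h010 : s₁ * t₁ * u₀ + s₀ * t₀ * u₀ + s₀ * t₁ * u₁ ≤ N) (h101 : s₀ * t₀ * u₁ + s₁ * t₁ * u₁ + s₁ * t₀ * u₀ ≤ N)
    (h001 : s₁ * t₀ * u₁ + s₀ * t₁ * u₁ + s₀ * t₀ * u₀ ≤ N) (h110 : s₀ * t₁ * u₀ + s₁ * t₀ * u₀ + s₁ * t₁ * u₁ ≤ N)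
    (hD : 8 * N ≤ 3 * ((s₀ + s₁) * (t₀ + t₁) * (u₀ + u₁)) + 31) :
    (s₀ + s₁) * (t₀ + t₁) * (u₀ + u₁) ≤ 126 := by
  rcases Nat.lt_or_gt_of_ne hs with hs' | hs' <;> rcases Nat.lt_or_gt_of_ne ht with ht' | ht' <;>
    rcases Nat.lt_or_gt_of_ne hu with hu' | hu'
  · have key := unbalanced_core31 N s₁ s₀ t₁ t₀ u₁ u₀ hs' ht' hu' (by linarith) (by linarith) (by linarith)
      (by linarith) (by linarith) (by linarith) (by linarith) (by linarith) (by linarith)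
    linarith
  · have key := unbalanced_core31 N s₁ s₀ t₁ t₀ u₀ u₁ hs' ht' hu' (by linarith) (by linarith) (by linarith)
      (by linarith) (by linarith) (by linarith) (by linarith) (by linarith) (by linarith)
    linarith
  · have key := unbalanced_core31 N s₁ s₀ t₀ t₁ u₁ u₀ hs' ht' hu' (by linarith) (by linarith) (by linarith)
      (by linarith) (by linarith) (by linarith) (by linarith) (by linarith) (by linarith)
    linarith
  · have key := unbalanced_core31 N s₁ s₀ t₀ t₁ u₀ u₁ hs' ht' hu' (by linarith) (by linarith) (by linarith)
      (by linarith) (by linarith) (by linarith) (by linarith) (by linarith) (by linarith)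
    linarith
  · have key := unbalanced_core31 N s₀ s₁ t₁ t₀ u₁ u₀ hs' ht' hu' (by linarith) (by linarith) (by linarith)
      (by linarith) (by linarith) (by linarith) (by linarith) (by linarith) (by linarith)
    linarith
  · have key := unbalanced_core31 N s₀ s₁ t₁ t₀ u₀ u₁ hs' ht' hu' (by linarith) (by linarith) (by linarith)
      (by linarith) (by linarith) (by linarith) (by linarith) (by linarith) (by linarith)
    linarith
  · have key := unbalanced_core31 N s₀ s₁ t₀ t₁ u₁ u₀ hs' ht' hu' (by linarith) (by linarith) (by linarith)
      (by linarith) (by linarith) (by linarith) (by linarith) (by linarith) (by linarith)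
    linarith
  · exact unbalanced_core31 N s₀ s₁ t₀ t₁ u₀ u₁ hs' ht' hu' h000 h111 h100 h011 h010 h101 h001 h110 hD

/-! ## Two balanced pairs -/

/-- **Slack `≤ 31` forces two balanced pairs.** If the eight vertex constraints hold, `V ≥ 127` and `8N ≤ 3V + 31`,
then two of the three part pairs are balanced. [folklore] -/
theorem two_balanced_of_vertex_bounds31 (N s₀ s₁ t₀ t₁ u₀ u₁ : ℕ)
    (h000 : s₁ * t₀ * u₀ + s₀ * t₁ * u₀ + s₀ * t₀ * u₁ ≤ N) (h111 : s₀ * t₁ * u₁ + s₁ * t₀ * u₁ + s₁ * t₁ * u₀ ≤ N)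
    (h100 : s₀ * t₀ * u₀ + s₁ * t₁ * u₀ + s₁ * t₀ * u₁ ≤ N) (h011 : s₁ * t₁ * u₁ + s₀ * t₀ * u₁ + s₀ * t₁ * u₀ ≤ N)
    (h010 : s₁ * t₁ * u₀ + s₀ * t₀ * u₀ + s₀ * t₁ * u₁ ≤ N) (h101 : s₀ * t₀ * u₁ + s₁ * t₁ * u₁ + s₁ * t₀ * u₀ ≤ N)
    (h001 : s₁ * t₀ * u₁ + s₀ * t₁ * u₁ + s₀ * t₀ * u₀ ≤ N) (h110 : s₀ * t₁ * u₀ + s₁ * t₀ * u₀ + s₁ * t₁ * u₁ ≤ N)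
    (hV : 127 ≤ (s₀ + s₁) * (t₀ + t₁) * (u₀ + u₁)) (hD : 8 * N ≤ 3 * ((s₀ + s₁) * (t₀ + t₁) * (u₀ + u₁)) + 31) :
    (s₀ = s₁ ∧ t₀ = t₁) ∨ (s₀ = s₁ ∧ u₀ = u₁) ∨ (t₀ = t₁ ∧ u₀ = u₁) := by
  by_cases hs : s₀ = s₁ <;> by_cases ht : t₀ = t₁ <;> by_cases hu : u₀ = u₁
  · exact Or.inl ⟨hs, ht⟩
  · exact Or.inl ⟨hs, ht⟩
  · exact Or.inr (Or.inl ⟨hs, hu⟩)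
  · -- `s` balanced only
    exfalso; subst hs
    have key := one_balanced_le31 N s₀ t₀ t₁ u₀ u₁ ht hu (by linarith) (by linarith) (by linarith) (by linarith) hD
    omega
  · exact Or.inr (Or.inr ⟨ht, hu⟩)
  · -- `t` balanced only: roles `(t, u, s)`
    exfalso; subst ht
    have key := one_balanced_le31 N t₀ u₀ u₁ s₀ s₁ hu hs (by linarith) (by linarith) (by linarith) (by linarith)
      (by linarith)
    linarith
  · -- `u` balanced only: roles `(u, s, t)`
    exfalso; subst hu
    have key := one_balanced_le31 N u₀ s₀ s₁ t₀ t₁ hs ht (by linarith) (by linarith) (by linarith) (by linarith)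
      (by linarith)
    linarith
  · exfalso
    have key := unbalanced_le31 N s₀ s₁ t₀ t₁ u₀ u₁ hs ht hu h000 h111 h100 h011 h010 h101 h001 h110 hD
    omega

/-- **`4 ∣ V`** whenever the eight vertex constraints hold, `V ≥ 127` and the total slack `8N − 3V` is at most `31`;
equivalently `8N − 3V ≡ 8N (mod 12)`. [folklore] -/
theorem four_dvd_volume_of_vertex_bounds31 (N s₀ s₁ t₀ t₁ u₀ u₁ : ℕ)
    (h000 : s₁ * t₀ * u₀ + s₀ * t₁ * u₀ + s₀ * t₀ * u₁ ≤ N) (h111 : s₀ * t₁ * u₁ + s₁ * t₀ * u₁ + s₁ * t₁ * u₀ ≤ N)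
    (h100 : s₀ * t₀ * u₀ + s₁ * t₁ * u₀ + s₁ * t₀ * u₁ ≤ N) (h011 : s₁ * t₁ * u₁ + s₀ * t₀ * u₁ + s₀ * t₁ * u₀ ≤ N)
    (h010 : s₁ * t₁ * u₀ + s₀ * t₀ * u₀ + s₀ * t₁ * u₁ ≤ N) (h101 : s₀ * t₀ * u₁ + s₁ * t₁ * u₁ + s₁ * t₀ * u₀ ≤ N)
    (h001 : s₁ * t₀ * u₁ + s₀ * t₁ * u₁ + s₀ * t₀ * u₀ ≤ N) (h110 : s₀ * t₁ * u₀ + s₁ * t₀ * u₀ + s₁ * t₁ * u₁ ≤ N)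
    (hV : 127 ≤ (s₀ + s₁) * (t₀ + t₁) * (u₀ + u₁)) (hD : 8 * N ≤ 3 * ((s₀ + s₁) * (t₀ + t₁) * (u₀ + u₁)) + 31) :
    4 ∣ (s₀ + s₁) * (t₀ + t₁) * (u₀ + u₁) := by
  rcases two_balanced_of_vertex_bounds31 N s₀ s₁ t₀ t₁ u₀ u₁ h000 h111 h100 h011 h010 h101 h001 h110 hV hD with
    ⟨hs, ht⟩ | ⟨hs, hu⟩ | ⟨ht, hu⟩
  · subst hs; subst ht; exact ⟨s₀ * t₀ * (u₀ + u₁), by ring⟩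
  · subst hs; subst hu; exact ⟨s₀ * (t₀ + t₁) * u₀, by ring⟩
  · subst ht; subst hu; exact ⟨(s₀ + s₁) * t₀ * u₀, by ring⟩

end Summit.MatrixMultiplication.OmegaCensus
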